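import Summits.AtomisticToContinuum.FouriersLaw.Theorems.HonestZwanzigRobinCoercivityBlockInputsCorollaries
import Summits.AtomisticToContinuum.FouriersLaw.Theorems.HonestZwanzigRobinCoercivityPositiveMemoryOfBlockInputs
import Summits.AtomisticToContinuum.FouriersLaw.Theorems.HonestZwanzigGeneratorSiteEnergy
import Summits.AtomisticToContinuum.FouriersLaw.Theorems.HonestZwanzigParityStatics
import Summits.AtomisticToContinuum.FouriersLaw.Theorems.HonestZwanzigNetworkReduction
import Summits.AtomisticToContinuum.FouriersLaw.Theorems.OddSectorIrreversibilityCorrectorTheoryUniformMixing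

/-!
# Fourier's law for the pinned anharmonic chain, CLOSED MODULO the five named inputs of line `limit-operator-memory-form`

Support file for the crux `stmt-AtomisticToContinuum-12695` (`RobinCoercivity`, route `HonestZwanzig`, sub-problem `FouriersLaw`).
Every item of route `HonestZwanzig` other than its three cruxes is closed in the tree (`NessUnique`, `OpenChainGreenKubo`,
`GeneratorSiteEnergy`, `ParityStatics`, `FeshbachIdentities`, `NetworkReduction`, and the deciding theorem
`Theses.HonestZwanzig.closes`), and the three cruxes follow from the line's shared rank-2 inputs
S = {`BlockBandDomination` (U′), `BlockBulkLimit` (L), `BlockDiagBound`} and residues R = {`BulkSymbolPositivity` (Q1),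
`CornerCoercivity` (Q2)} (`orthogonalOhm_of_blockInputs'`, `positiveMemory_of_blockInputs`, the transfer theorem). Hence the
SUB-PROBLEM STATEMENT `_root_.FouriersLaw` (Fourier's law for `pinnedChain`, all parameters `> 0`) is closed modulo S ∪ R —
five named, N-uniform statements about the orthogonal-dynamics current memory of the deterministic anharmonic chain (all open:
barriers `FixedLengthNoConductivityControl`, `MacroErgodicityHypothesis`). This theorem is CONDITIONAL by design (it takes S ∪ R as
hypotheses); it records the reduction, it does not claim the conjunct.
-/

noncomputable section

open Summit.AtomisticToContinuum.FouriersLaw.Theses.HonestZwanzig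

namespace Summit.AtomisticToContinuum.FouriersLaw.Theorems.HonestZwanzig.Robin

/-- **`FouriersLaw` (the sub-problem statement) from the five named inputs S ∪ R of line `limit-operator-memory-form`.** -/
theorem fouriersLaw_of_blockInputs (hU : BlockBandDomination) (hL : BlockBulkLimit) (hD : BlockDiagBound)
    (hQ1 : BulkSymbolPositivity) (hQ2 : CornerCoercivity) : _root_.FouriersLaw :=
  closes NessUnique_holds
    Summit.AtomisticToContinuum.FouriersLaw.Theorems.OddSectorIrreversibility.Corrector.openChainGreenKubo_holds
    Summit.AtomisticToContinuum.FouriersLaw.Theorems.HonestZwanzig.generatorSiteEnergy_proof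
    Summit.AtomisticToContinuum.FouriersLaw.Theorems.HonestZwanzig.parityStatics_proof
    stub_feshbachIdentities
    (orthogonalOhm_of_blockInputs' hU hL hD) (positiveMemory_of_blockInputs hU hL hQ1)
    ((robinCoercivity_iff_residues' hU hL hD).2 ⟨hQ1, hQ2⟩)
    Summit.AtomisticToContinuum.FouriersLaw.Theorems.HonestZwanzig.NetworkReduction.networkReduction_proof

end Summit.AtomisticToContinuum.FouriersLaw.Theorems.HonestZwanzig.Robin

end
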